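import Summits.AtomisticToContinuum.Crystallization.Theorems.MinimiserShells.Negative.LoadBearing

/-!
# Negative knowledge for crux `MinimiserShells` (stmt-AtomisticToContinuum-9225) — the CEILING on the
# constant of the intended first-order mechanism `E_P[h] ≥ e* + c·P(bad)` (standing disprover, gen 1–2)

`LinearPricing c` — for every point-stationary `δ`-hard-core probability law,
`e* + c·P(bad root shell) ≤ E_P[h]` — is the expectation inequality the crux docstring and the round-1/2
idea cards aim at (it suffices for the crux for every `c > 0` and contains `e_uni ≥ e*`; those two
POSITIVE readings live in the workfile, not here).  Certified here: the constant is CAPPED by every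
cheap law with bad shells —
`linearPricing_ceiling` (`c ≤ E_P[h] − e*` for an a.s.-bad point-stationary hard-core law; feed it the
Palm law of relaxed fcc/hcp strained tetragonally just past the `a/100` matching threshold:
`c ≤ 4.4e-4 ≈ 0.06 %·|e*|`, kit j008791) and `linearPricing_ceiling_partial` (`c ≤ (E_P[h] − e*)/q`
whenever `P(bad) ≥ q`: dilute defects, one displaced atom per `M` sites, give `c ≤ ΔE/#bad shells`,
kit j009685).  Any certificate for the fine `(a/100)` target must therefore resolve the Lennard-Jones
landscape to `≈ 5e-4` relative, uniformly over hard-core configurations — five times the hcp/fcc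
splitting.  Supports item stmt-AtomisticToContinuum-9225; workfile `Cruxes/MinimiserShells/Disproof.lean`
§5, §8.
-/

noncomputable section

open MeasureTheory
open scoped ENNReal BigOperators

namespace Summit.AtomisticToContinuum.Crystallization.Theorems.MinimiserShells.Negative.PricingCeiling

open Literature.Probability.Process
open Literature.MathematicalPhysics.StatisticalMechanics
open Literature.Geometry.DiscreteGeometry
open Summit.AtomisticToContinuum.Crystallization.Theorems.MinimiserShells.Negative.LoadBearing
  (eStar meanRootEnergy GoodShell)

/-- Euclidean 3-space. -/
abbrev E3 := EuclideanSpace ℝ (Fin 3)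

/-- **Linear pricing with constant `c`**: for every point-stationary `δ`-hard-core probability law,
`e* + c·P(bad root shell) ≤ E_P[h]` (outer measure of the bad event, `toReal`). -/
def LinearPricing (c : ℝ) : Prop :=
  ∀ δ : ℝ, 0 < δ → ∀ P : Measure (Measure E3), IsProbabilityMeasure P →
    (∀ᵐ μ ∂P, IsRootedHardCore δ μ) → IsPointStationaryLaw P →
    eStar + c * (P {μ | ¬ GoodShell μ}).toReal ≤ meanRootEnergy P

/-- **The ceiling on `c`.** Every point-stationary `δ`-hard-core probability law whose root shell is
almost surely BAD caps the constant: `c ≤ E_P[h] − e*`. [folklore] -/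
theorem linearPricing_ceiling {c : ℝ} (h : LinearPricing c) {δ : ℝ} (hδ : 0 < δ)
    (P : Measure (Measure E3)) [IsProbabilityMeasure P] (hcore : ∀ᵐ μ ∂P, IsRootedHardCore δ μ)
    (hstat : IsPointStationaryLaw P) (hbad : ∀ᵐ μ ∂P, ¬ GoodShell μ) :
    c ≤ meanRootEnergy P - eStar := by
  have hineq := h δ hδ P inferInstance hcore hstat
  have hone : (P {μ | ¬ GoodShell μ}).toReal = 1 := by
    have : P {μ | ¬ GoodShell μ} = 1 := by
      have hc : P {μ | ¬ GoodShell μ}ᶜ = 0 := by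
        rw [ae_iff] at hbad
        simpa [Set.compl_setOf] using hbad
      have := measure_add_measure_compl₀ (μ := P) (s := {μ | ¬ GoodShell μ}) ?_
      · rw [hc, add_zero, measure_univ] at this
        exact this
      · exact NullMeasurableSet.of_compl (NullMeasurableSet.of_null hc)
    rw [this, ENNReal.toReal_one]
  rw [hone, mul_one] at hineq
  linarith

/-- **Ceiling from a partially bad law**: a point-stationary hard-core law with `P(bad) ≥ q > 0`
caps the constant, `c ≤ (E_P[h] − e*)/q` — dilute defects (one displaced atom per `M` sites:
`q = #bad shells/M`, `E − e* = ΔE/M`) give `c ≤ ΔE/#bad shells` (kit j009685). [folklore] -/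
theorem linearPricing_ceiling_partial {c : ℝ} (hc : 0 ≤ c) (h : LinearPricing c) {δ : ℝ}
    (hδ : 0 < δ) (P : Measure (Measure E3)) [IsProbabilityMeasure P]
    (hcore : ∀ᵐ μ ∂P, IsRootedHardCore δ μ) (hstat : IsPointStationaryLaw P) {q : ℝ} (hq : 0 < q)
    (hbad : q ≤ (P {μ | ¬ GoodShell μ}).toReal) :
    c ≤ (meanRootEnergy P - eStar) / q := by
  have hineq := h δ hδ P inferInstance hcore hstat
  rw [le_div_iff₀ hq]
  nlinarith [mul_le_mul_of_nonneg_left hbad hc]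


end Summit.AtomisticToContinuum.Crystallization.Theorems.MinimiserShells.Negative.PricingCeiling
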